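import Literature.NumberTheory.Automorphic.BrandtTypeSet
import Literature.NumberTheory.Automorphic.DefiniteMaximalOrdersLeftOrderFibres
import Literature.NumberTheory.Automorphic.DefiniteMaximalOrdersRamifiedTrace
import Literature.NumberTheory.Automorphic.DefiniteMaximalOrdersClassNumberOne
import Literature.NumberTheory.Automorphic.DefiniteOrdersClassNumbersMass
import HarnessLib

/-!
# Deuring's type number formula for the definite quaternion algebra of prime discriminant

For a maximal order `O` of the definite quaternion algebra `B = B_{p,∞}` over `ℚ` of prime discriminant `p` (a Brandt setup
`S : XiSetup 1 p`), the **type number** `t = # Typ O` — the number of isomorphism (= conjugacy) classes of maximal orders of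
`B`, the tree's `Brandt.TypeSet` of `BrandtTypeSet.lean` — is computed from the class number `h = # Cls O` and imaginary
quadratic class numbers (M. Deuring 1951, as in Voight's *Quaternion Algebras* Prop. 30.9.2): `t = 1` for `p = 2, 3`, and for
`p ≥ 5`

  `# Typ O = ½ # Cls O + ¼ ([h(-p)] + h(-4p))`,  `[h(-p)] = h(-p)` if `p ≡ 3 (mod 4)`, `0` otherwise

(`XiSetup.natCard_typeSet_eq_deuring`; in `ℕ`: `XiSetup.four_mul_natCard_typeSet_eq`; weighted form
`XiSetup.natCard_typeSet_eq_deuring_weighted`; combined with Eichler's class number formula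
`XiSetup.natCard_typeSet_eq_deuring_eichler`; and Voight 30.9.10's uniform form `4t = 2h + c_p · h_K`, `c_p = 1, 4, 2` for
`p ≡ 1 (4), 3 (8), 7 (8)`, `XiSetup.four_mul_natCard_typeSet_eq_classNumber_mul`).

## The argument (Voight §30.9, run through the Brandt matrix at the ramified prime)

1. (§1, on top of `DefiniteMaximalOrdersLeftOrderFibres.lean`) The fibres of the type map `Cls O → Typ O` are the orbits of
   the involution `W : [I] ↦ [I P]`, `P` the two-sided prime of `O` above `p`: `typeOf [I'] = typeOf [I] ⟺ [I'] ∈ {[I], [I P]}`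
   (`XiSetup.typeOf_eq_typeOf_iff_eq_or_eq`). Counting classes along the fibres, `2t = h + #{c : W c = c}`
   (`XiSetup.two_mul_natCard_typeSet`), and `W c = c` iff the left order `O_L(I_c)` has an element of reduced norm `p`
   (`XiSetup.mk_rep_mul_normPrimeIdeal_eq_self_iff`) iff `T(p)_{cc} = 1`; so `2t = h + tr T(p)`
   (`XiSetup.two_mul_natCard_typeSet_eq_card_add_trace` — Voight's (30.9.3)–(30.9.4)).
2. (§2, on top of `DefiniteMaximalOrdersRamifiedTrace.lean`) Eichler's trace formula at `n = p` — only trace `0` contributes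
   for `p ≥ 5`, and the local factor at the ramified prime is `1` — gives `tr T(p) = ½ (h(-4p) + [h(-p)])`, whence Deuring's
   formula; the conductor-`2` step `h(-4p) = (3 - ρ₂) h(-p)` for `p ≡ 3 (mod 4)` (`weightedClassNumber_neg_four_mul_prime`,
   from the tree's `weightedClassNumber_step`) gives the uniform form 30.9.10 (`classNumber_bracket_add_classNumber_eq`).
3. (§2–§3) Consequences: `h < 2t ≤ 2h` (`XiSetup.natCard_classSet_lt_two_mul_natCard_typeSet`); some maximal order of `B`
   always contains an element of reduced norm `p` (`XiSetup.exists_leftOrder_rep_reducedNorm_eq_prime`), and `t = h` iff every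
   one does (`XiSetup.natCard_typeSet_eq_natCard_classSet_iff`); **`t = 1 ⟺ p ∈ {2, 3, 5, 7, 13}`**
   (`XiSetup.natCard_typeSet_eq_one_iff_of_prime`); the first values `t(11) = t(17) = t(19) = 2`, `t(23) = 3`, and `p = 37`,
   the first prime with `t < h` (`h = 3`, `t = 2`; `XiSetup.natCard_typeSet_thirtySeven`).

## References

* [Voight2021] J. Voight, *Quaternion Algebras*, GTM 288 (2021): §17.4 (types), Cor. 18.5.12, Prop. 30.9.2 and its proof
  (30.9.1)–(30.9.8), 30.9.10, Thm. 25.4.1 and Exercise 30.6 (class number lists), Thm. 30.1.5 (Eichler's formula).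
* [VignerasLNM800] M.-F. Vignéras, *Arithmétique des algèbres de quaternions*, LNM 800: Ch. V §2 (Brandt matrices at the
  ramified primes), Ch. III §5 (trace formula).
* [Cox2013] D. A. Cox, *Primes of the form x² + ny²*, 2nd ed.: Thm. 7.24, Cor. 7.28 (class numbers of non-maximal orders).
-/

noncomputable section

open Finset
open scoped Pointwise

namespace Literature.NumberTheory.Automorphic

open HeckeTraceFormulaGL2Level
open Literature.NumberTheory.QuadraticFields.Quadratic

namespace Brandt

variable {p : ℕ} [hp : Fact p.Prime] (S : XiSetup 1 p)

/-! ## §1 The fibres of the type map are the orbits of `c ↦ [I_c P]` -/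

section Fibres

/-- **The involution `c ↦ [I_c P]` preserves the type**: `typeOf [I_c P] = typeOf c`. [cite: Voight2021, Remark 17.4.15 and Prop. 18.5.10] -/
theorem XiSetup.typeOf_mk_rep_mul_normPrimeIdeal (c : ClassSet S.O) :
    typeOf S.O (Quotient.mk (rightClassSetoid S.O) ⟨c.rep * normPrimeIdeal S.O p, S.rep_mul_normPrimeIdeal_mem c⟩) =
      typeOf S.O c := by
  obtain ⟨β, hβ⟩ := S.exists_leftOrder_rep_mk_mul_normPrimeIdeal_eq_conj c
  exact typeOf_eq_typeOf_iff.mpr ⟨β, hβ⟩ |>.symm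

/-- **The fibres of `typeOf`**: `typeOf c' = typeOf c ⟹ c' = c ∨ c' = [I_c P]`. [cite: Voight2021, Prop. 18.5.10 and 18.4.8] -/
theorem XiSetup.eq_or_eq_of_typeOf_eq {c c' : ClassSet S.O} (h : typeOf S.O c' = typeOf S.O c) :
    c' = c ∨ c' = Quotient.mk (rightClassSetoid S.O) ⟨c.rep * normPrimeIdeal S.O p, S.rep_mul_normPrimeIdeal_mem c⟩ := by
  obtain ⟨β, hβ⟩ := typeOf_eq_typeOf_iff.mp h.symm
  exact S.eq_or_eq_mk_mul_normPrimeIdeal_of_leftOrder_conj hβ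

/-- **Each fibre of the type map is the orbit `{c, [I_c P]}`**: `typeOf c' = typeOf c ⟺ c' = c ∨ c' = [I_c P]` — the
left orders `O_L(I), O_L(I')` are conjugate iff `I' ∼ I` or `I' ∼ I P` (`Pic O_L(I) ≃ ℤ/2ℤ` generated by the prime above `p`).
[cite: Voight2021, Prop. 18.5.10 and 18.4.8] -/
theorem XiSetup.typeOf_eq_typeOf_iff_eq_or_eq {c c' : ClassSet S.O} :
    typeOf S.O c' = typeOf S.O c ↔
      c' = c ∨ c' = Quotient.mk (rightClassSetoid S.O) ⟨c.rep * normPrimeIdeal S.O p, S.rep_mul_normPrimeIdeal_mem c⟩ := by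
  refine ⟨S.eq_or_eq_of_typeOf_eq, ?_⟩
  rintro (rfl | rfl)
  · rfl
  · exact S.typeOf_mk_rep_mul_normPrimeIdeal c

/-- **`[I_c P] = [I_c]` iff `O_L(I_c)` contains an element of reduced norm `p`** (i.e. iff the prime of `O_L(I_c)` above `p` is
principal; Voight: "`J` is principal if and only if there exists `α ∈ O` with `nrd(α) = p`"). [cite: Voight2021, Prop. 30.9.2 (proof, first paragraph)] -/
theorem XiSetup.mk_rep_mul_normPrimeIdeal_eq_self_iff (c : ClassSet S.O) :
    Quotient.mk (rightClassSetoid S.O) ⟨c.rep * normPrimeIdeal S.O p, S.rep_mul_normPrimeIdeal_mem c⟩ = c ↔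
      ∃ x ∈ leftOrder c.rep, reducedNorm ℚ S.D x = p := by
  have hpp := hp.out
  have h1 := S.matrix_ramified_diag c
  have h2 := S.two_mul_weight_mul_matrix_diag hpp.ne_zero c
  have hw : 0 < weight S.O c := S.weight_pos c (S.finite_units c)
  haveI : Finite {x : S.D // x ∈ leftOrder c.rep ∧ reducedNorm ℚ S.D x = (p : ℕ)} :=
    (S.finite_setOf_mem_leftOrder_reducedNorm_eq c _).to_subtype
  constructor
  · intro hc
    rw [if_pos hc] at h1
    rw [h1, mul_one] at h2
    have hne : Nat.card {x : S.D // x ∈ leftOrder c.rep ∧ reducedNorm ℚ S.D x = (p : ℕ)} ≠ 0 := by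
      intro h0
      rw [h0] at h2
      push_cast at h2
      omega
    obtain ⟨⟨x, hx, hn⟩⟩ := (Nat.card_ne_zero.mp hne).1
    exact ⟨x, hx, hn⟩
  · rintro ⟨x, hx, hn⟩
    by_contra hc
    rw [if_neg hc] at h1
    rw [h1, mul_zero] at h2
    have hne : Nat.card {x : S.D // x ∈ leftOrder c.rep ∧ reducedNorm ℚ S.D x = (p : ℕ)} ≠ 0 :=
      Nat.card_ne_zero.mpr ⟨⟨⟨x, hx, hn⟩⟩, inferInstance⟩
    omega

/-- **`2t = h + #{c : [I_c P] = [I_c]}`** — counting `Cls O` along the fibres `{c, [I_c P]}` of the type map: a fibre has one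
element iff its class is fixed by the involution, two otherwise (Voight Cor. 18.5.12: `# Cls O = Σ_{[O']} [Idl O' : PIdl O']`
with `[Idl O' : PIdl O'] ∈ {1, 2}`). [cite: Voight2021, Cor. 18.5.12 and (30.9.1)] -/
theorem XiSetup.two_mul_natCard_typeSet :
    2 * Nat.card (TypeSet S.O) = Nat.card (ClassSet S.O) +
      Nat.card {c : ClassSet S.O //
        Quotient.mk (rightClassSetoid S.O) ⟨c.rep * normPrimeIdeal S.O p, S.rep_mul_normPrimeIdeal_mem c⟩ = c} := by
  classical
  haveI : Finite (TypeSet S.O) := S.finite_typeSet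
  letI : Fintype (TypeSet S.O) := Fintype.ofFinite _
  letI : Fintype (ClassSet S.O) := Fintype.ofFinite _
  set W : ClassSet S.O → ClassSet S.O := fun c =>
    Quotient.mk (rightClassSetoid S.O) ⟨c.rep * normPrimeIdeal S.O p, S.rep_mul_normPrimeIdeal_mem c⟩ with hW
  have hWW : ∀ c, W (W c) = c := fun c => S.mk_rep_mul_normPrimeIdeal_mul_normPrimeIdeal c
  have hfib : ∀ c c' : ClassSet S.O, typeOf S.O c' = typeOf S.O c ↔ c' = c ∨ c' = W c := fun c c' =>
    S.typeOf_eq_typeOf_iff_eq_or_eq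
  change 2 * Nat.card (TypeSet S.O) = Nat.card (ClassSet S.O) + Nat.card {c : ClassSet S.O // W c = c}
  rw [Nat.card_eq_fintype_card, Nat.card_eq_fintype_card, Nat.card_eq_fintype_card, Fintype.card_subtype]
  set f : ClassSet S.O → ℕ := fun c => 1 + if W c = c then 1 else 0 with hf
  have hsum : ∑ c, f c = Fintype.card (ClassSet S.O) + (Finset.univ.filter fun c => W c = c).card := by
    simp only [hf, Finset.sum_add_distrib, Finset.sum_const, smul_eq_mul, mul_one, Finset.card_univ, Finset.sum_boole,
      Nat.cast_id]
  rw [← hsum, ← Finset.sum_fiberwise_of_maps_to (s := Finset.univ) (t := Finset.univ) (g := typeOf S.O)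
    (fun _ _ => Finset.mem_univ _) f]
  rw [show 2 * Fintype.card (TypeSet S.O) = ∑ _y : TypeSet S.O, 2 by
    rw [Finset.sum_const, smul_eq_mul, Finset.card_univ, mul_comm]]
  refine Finset.sum_congr rfl fun y _ => ?_
  obtain ⟨c₀, rfl⟩ := typeOf_surjective y
  by_cases hfix : W c₀ = c₀
  · have hfib1 : (Finset.univ.filter fun c' => typeOf S.O c' = typeOf S.O c₀) = {c₀} := by
      ext c'
      rw [Finset.mem_filter, Finset.mem_singleton, hfib]
      simp [hfix]
    rw [hfib1, Finset.sum_singleton, hf]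
    simp [hfix]
  · have hfib2 : (Finset.univ.filter fun c' => typeOf S.O c' = typeOf S.O c₀) = {c₀, W c₀} := by
      ext c'
      rw [Finset.mem_filter, Finset.mem_insert, Finset.mem_singleton, hfib]
      simp
    rw [hfib2, Finset.sum_pair (Ne.symm hfix), hf]
    have h2 : W (W c₀) ≠ W c₀ := by rw [hWW]; exact Ne.symm hfix
    simp [hfix, h2]

/-- **(30.9.3): `2 # Typ O = # Cls O + #{[I] : O_L(I) has an element of reduced norm p}`** (equivalently: whose prime above
`p` is principal). [cite: Voight2021, (30.9.3)] -/
theorem XiSetup.two_mul_natCard_typeSet_eq_card_add_card_exists :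
    2 * Nat.card (TypeSet S.O) = Nat.card (ClassSet S.O) +
      Nat.card {c : ClassSet S.O // ∃ x ∈ leftOrder c.rep, reducedNorm ℚ S.D x = p} := by
  rw [S.two_mul_natCard_typeSet]
  congr 1
  exact Nat.card_congr (Equiv.subtypeEquivRight fun c => S.mk_rep_mul_normPrimeIdeal_eq_self_iff c)

/-- **`2t = h + tr T(p)`**: the trace of the Brandt matrix at the ramified prime counts the classes fixed by `c ↦ [I_c P]`.
[cite: Voight2021, (30.9.3)–(30.9.4)] [cite: VignerasLNM800, Ch. V §2 (Brandt matrices at the ramified primes)] -/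
theorem XiSetup.two_mul_natCard_typeSet_eq_card_add_trace [Fintype (ClassSet S.O)] :
    (2 * Nat.card (TypeSet S.O) : ℤ) = Nat.card (ClassSet S.O) + ∑ c, matrix S.O p c c := by
  classical
  have h := S.two_mul_natCard_typeSet
  have htr : ∑ c, matrix S.O p c c = (Nat.card {c : ClassSet S.O //
      Quotient.mk (rightClassSetoid S.O) ⟨c.rep * normPrimeIdeal S.O p, S.rep_mul_normPrimeIdeal_mem c⟩ = c} : ℤ) := by
    rw [Nat.card_eq_fintype_card, Fintype.card_subtype, Finset.natCast_card_filter]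
    refine Finset.sum_congr rfl fun c _ => ?_
    rw [S.matrix_ramified_diag c]
  rw [htr]
  exact_mod_cast h

/-- **`h ≤ 2t`**: together with `t ≤ h` (`natCard_typeSet_le`), the type number of a maximal order of `B_{p,∞}` satisfies
`h/2 ≤ t ≤ h`. [cite: Voight2021, Cor. 18.5.12] -/
theorem XiSetup.natCard_classSet_le_two_mul_natCard_typeSet : Nat.card (ClassSet S.O) ≤ 2 * Nat.card (TypeSet S.O) := by
  rw [S.two_mul_natCard_typeSet]
  exact Nat.le_add_right _ _

/-- **`# Typ O = # Cls O` iff every left order `O_L(I)` contains an element of reduced norm `p`** (iff every class is fixed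
by `[I] ↦ [I P]`, iff `T(p)` is the identity matrix). [cite: Voight2021, Cor. 18.5.12 and (30.9.3)] -/
theorem XiSetup.natCard_typeSet_eq_natCard_classSet_iff :
    Nat.card (TypeSet S.O) = Nat.card (ClassSet S.O) ↔
      ∀ c : ClassSet S.O, ∃ x ∈ leftOrder c.rep, reducedNorm ℚ S.D x = p := by
  have h := S.two_mul_natCard_typeSet_eq_card_add_card_exists
  constructor
  · intro ht
    by_contra hne
    push Not at hne
    obtain ⟨c, hc⟩ := hne
    have hlt := Finite.card_subtype_lt (p := fun c : ClassSet S.O => ∃ x ∈ leftOrder c.rep, reducedNorm ℚ S.D x = p)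
      (x := c) (by simpa using hc)
    omega
  · intro hall
    have e : Nat.card {c : ClassSet S.O // ∃ x ∈ leftOrder c.rep, reducedNorm ℚ S.D x = p} = Nat.card (ClassSet S.O) :=
      Nat.card_congr (Equiv.subtypeUnivEquiv hall)
    omega

end Fibres

/-! ## §2 Deuring's type number formula -/

section Deuring

/-- **Deuring's type number formula, weighted-class-number form**: for a maximal order `O` of the definite quaternion algebra
of prime discriminant `p ≥ 5`, `# Typ O = ½ # Cls O + ¼ (h_w(-4p) + [h_w(-p)])` (`h_w` = the tree's `weightedClassNumber`,
the class number for these discriminants `< -4`). [cite: Voight2021, Prop. 30.9.2] -/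
theorem XiSetup.natCard_typeSet_eq_deuring_weighted (hp5 : 5 ≤ p) :
    (Nat.card (TypeSet S.O) : ℚ) = (Nat.card (ClassSet S.O) : ℚ) / 2 +
      (weightedClassNumber (-(4 * (p : ℤ))) + if p % 4 = 3 then weightedClassNumber (-(p : ℤ)) else 0) / 4 := by
  letI : Fintype (ClassSet S.O) := Fintype.ofFinite _
  have h := S.two_mul_natCard_typeSet_eq_card_add_trace
  have htr := S.trace_matrix_ramified hp5
  have h' : (2 * Nat.card (TypeSet S.O) : ℚ) = Nat.card (ClassSet S.O) + ∑ c, (matrix S.O p c c : ℚ) := by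
    have := congrArg (fun z : ℤ => (z : ℚ)) h
    push_cast at this
    exact this
  rw [htr] at h'
  linarith

/-- **DEURING'S TYPE NUMBER FORMULA (Voight Prop. 30.9.2; Deuring 1951).** Let `B` be the definite quaternion algebra over `ℚ`
of prime discriminant `p ≥ 5` and `O ⊂ B` a maximal order. Then
`# Typ O = ½ # Cls O + ¼ ([h(-p)] + h(-4p))`, where `[h(-p)] = h(-p)` when `p ≡ 3 (mod 4)` and is `0` otherwise
(`h` = the class number of primitive positive definite binary quadratic forms, the tree's `BinQF.classNumber`).
[cite: Voight2021, Prop. 30.9.2] -/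
theorem XiSetup.natCard_typeSet_eq_deuring (hp5 : 5 ≤ p) :
    (Nat.card (TypeSet S.O) : ℚ) = (Nat.card (ClassSet S.O) : ℚ) / 2 +
      (((if p % 4 = 3 then BinQF.classNumber (-(p : ℤ)) else 0 : ℕ) : ℚ) + BinQF.classNumber (-(4 * (p : ℤ)))) / 4 := by
  have h := S.natCard_typeSet_eq_deuring_weighted hp5
  rw [weightedClassNumber_of_ne (by omega) (by omega), weightedClassNumber_of_ne (by omega) (by omega)] at h
  rw [h]
  split_ifs <;> push_cast <;> ring

/-- Deuring's formula in `ℕ`: **`4 · # Typ O = 2 · # Cls O + [h(-p)] + h(-4p)`** (`p ≥ 5`). [cite: Voight2021, Prop. 30.9.2] -/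
theorem XiSetup.four_mul_natCard_typeSet_eq (hp5 : 5 ≤ p) :
    4 * Nat.card (TypeSet S.O) = 2 * Nat.card (ClassSet S.O) +
      ((if p % 4 = 3 then BinQF.classNumber (-(p : ℤ)) else 0) + BinQF.classNumber (-(4 * (p : ℤ)))) := by
  have h := S.natCard_typeSet_eq_deuring hp5
  have key : ((4 * Nat.card (TypeSet S.O) : ℕ) : ℚ) = ((2 * Nat.card (ClassSet S.O) +
      ((if p % 4 = 3 then BinQF.classNumber (-(p : ℤ)) else 0) + BinQF.classNumber (-(4 * (p : ℤ)))) : ℕ) : ℚ) := by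
    push_cast at h ⊢
    rw [h]
    ring
  exact_mod_cast key

/-- **Deuring's formula combined with Eichler's class number formula** (`# Cls O = (p-1)/12 + (1 - (-4/p))/4 + (1 - (-3/p))/3`,
the tree's `natCard_classSet_eq_legendreSym`): for `p ≥ 5`,
`# Typ O = (p-1)/24 + (1 - (-4/p))/8 + (1 - (-3/p))/6 + ([h(-p)] + h(-4p))/4`. [cite: Voight2021, Prop. 30.9.2 and Thm. 30.1.5] -/
theorem XiSetup.natCard_typeSet_eq_deuring_eichler (hp5 : 5 ≤ p) :
    (Nat.card (TypeSet S.O) : ℚ) = ((p : ℚ) - 1) / 24 + (1 - (legendreSym p (-4) : ℚ)) / 8 + (1 - (legendreSym p (-3) : ℚ)) / 6 +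
      (((if p % 4 = 3 then BinQF.classNumber (-(p : ℤ)) else 0 : ℕ) : ℚ) + BinQF.classNumber (-(4 * (p : ℤ)))) / 4 := by
  have h := S.natCard_typeSet_eq_deuring hp5
  have hh := Brandt.XiSetup.natCard_classSet_eq_legendreSym (p := p) (by omega) S
  rw [hh] at h
  linarith

/-- **`h(-4p)` against `h(-p)` for `p ≡ 3 (mod 4)`** — the conductor-`2` step (Cox Cor. 7.28, in the tree's weighted form
`weightedClassNumber_step`): `h_w(-4p) = (3 - ρ₂) · h_w(-p)` with `ρ₂ = 1 + χ₈(-p)`, i.e. `h_w(-4p) = 3 h_w(-p)` for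
`p ≡ 3 (mod 8)` and `h_w(-4p) = h_w(-p)` for `p ≡ 7 (mod 8)`. [cite: Cox2013, Thm. 7.24 and Cor. 7.28] [cite: Voight2021, 30.9.10] -/
theorem weightedClassNumber_neg_four_mul_prime (hp3 : p % 4 = 3) :
    weightedClassNumber (-(4 * (p : ℤ))) = (if p % 8 = 3 then 3 else 1) * weightedClassNumber (-(p : ℤ)) := by
  have hpp := hp.out
  have hlt : (0 : ℤ) ^ 2 < 4 * (p : ℕ) := by have := hpp.pos; push_cast; linarith
  have hf2 : 1 * 2 ∈ ellipticConductors 0 p := by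
    rw [one_mul]; exact mem_ellipticConductors_zero_prime_iff.mpr (Or.inr ⟨rfl, hp3⟩)
  have step := weightedClassNumber_step hlt Nat.prime_two hf2
  have e1 : ((0 : ℤ) ^ 2 - 4 * (p : ℕ)) / ((1 : ℕ) : ℤ) ^ 2 = -(4 * (p : ℤ)) := by push_cast; omega
  have e2 : ((0 : ℤ) ^ 2 - 4 * (p : ℕ)) / (((1 * 2 : ℕ)) : ℤ) ^ 2 = -(p : ℤ) := by push_cast; omega
  rw [e1, e2] at step
  -- `ρ₂(t₂, n₂) = 1 + χ₈(t₂² - 4 n₂) = 1 + χ₈(-p)`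
  have hdisc : tOf 0 (p : ℕ) (1 * 2) ^ 2 - 4 * nOf 0 (p : ℕ) (1 * 2) = -(p : ℤ) := by
    rw [← disc_div_sq hlt hf2]; exact e2
  have hrho := rho_two_eq_one_add_χ₈' (tOf 0 (p : ℕ) (1 * 2)) (nOf 0 (p : ℕ) (1 * 2))
  rw [hdisc, ZMod.χ₈_int_eq_if_mod_eight, if_neg (by omega)] at hrho
  by_cases h8 : p % 8 = 3
  · rw [if_neg (by omega)] at hrho
    have hρ : (rho 2 (tOf 0 (p : ℕ) (1 * 2)) (nOf 0 (p : ℕ) (1 * 2)) : ℚ) = 0 := by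
      exact_mod_cast (by omega : rho 2 (tOf 0 (p : ℕ) (1 * 2)) (nOf 0 (p : ℕ) (1 * 2)) = 0)
    rw [step, hρ, if_pos h8]; push_cast; ring
  · rw [if_pos (Or.inl (by omega))] at hrho
    have hρ : (rho 2 (tOf 0 (p : ℕ) (1 * 2)) (nOf 0 (p : ℕ) (1 * 2)) : ℚ) = 2 := by
      exact_mod_cast (by omega : rho 2 (tOf 0 (p : ℕ) (1 * 2)) (nOf 0 (p : ℕ) (1 * 2)) = 2)
    rw [step, hρ, if_neg h8]; push_cast; ring

/-- **Voight 30.9.10: the sum of class numbers in Deuring's formula, uniformly in terms of the class number `h_K` of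
`K = ℚ(√-p)`** (`h_K = h(-4p)` for `p ≡ 1 (mod 4)`, `h_K = h(-p)` for `p ≡ 3 (mod 4)`):
`[h(-p)] + h(-4p) = h_K · 1, 4, 2` according as `p ≡ 1 (mod 4)`, `p ≡ 3 (mod 8)`, `p ≡ 7 (mod 8)` (`p ≥ 5`).
[cite: Voight2021, 30.9.10] -/
theorem classNumber_bracket_add_classNumber_eq (hp5 : 5 ≤ p) :
    ((if p % 4 = 3 then BinQF.classNumber (-(p : ℤ)) else 0) + BinQF.classNumber (-(4 * (p : ℤ)))) =
      BinQF.classNumber (if p % 4 = 1 then -(4 * (p : ℤ)) else -(p : ℤ)) *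
        (if p % 4 = 1 then 1 else if p % 8 = 3 then 4 else 2) := by
  have hpp := hp.out
  have hodd : p % 2 = 1 := Nat.odd_iff.mp (hpp.odd_of_ne_two (by omega))
  by_cases h1 : p % 4 = 1
  · rw [if_neg (by omega), if_pos h1, if_pos h1, zero_add, mul_one]
  · have h3 : p % 4 = 3 := by omega
    have key := weightedClassNumber_neg_four_mul_prime (p := p) h3
    rw [weightedClassNumber_of_ne (by omega) (by omega), weightedClassNumber_of_ne (by omega) (by omega)] at key
    rw [if_pos h3, if_neg h1, if_neg h1]
    by_cases h8 : p % 8 = 3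
    · rw [if_pos h8] at key ⊢
      have e : BinQF.classNumber (-(4 * (p : ℤ))) = 3 * BinQF.classNumber (-(p : ℤ)) := by exact_mod_cast key
      omega
    · rw [if_neg h8] at key ⊢
      have e : BinQF.classNumber (-(4 * (p : ℤ))) = 1 * BinQF.classNumber (-(p : ℤ)) := by exact_mod_cast key
      omega

/-- Deuring's formula in the uniform form of Voight 30.9.10: **`4 · # Typ O = 2 · # Cls O + c_p · h_K`**, `h_K` the class
number of `ℚ(√-p)` and `c_p = 1, 4, 2` for `p ≡ 1 (mod 4)`, `p ≡ 3 (mod 8)`, `p ≡ 7 (mod 8)` (`p ≥ 5`).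
[cite: Voight2021, Prop. 30.9.2 and 30.9.10] -/
theorem XiSetup.four_mul_natCard_typeSet_eq_classNumber_mul (hp5 : 5 ≤ p) :
    4 * Nat.card (TypeSet S.O) = 2 * Nat.card (ClassSet S.O) +
      BinQF.classNumber (if p % 4 = 1 then -(4 * (p : ℤ)) else -(p : ℤ)) *
        (if p % 4 = 1 then 1 else if p % 8 = 3 then 4 else 2) := by
  rw [S.four_mul_natCard_typeSet_eq hp5, classNumber_bracket_add_classNumber_eq hp5]

/-- **`# Cls O < 2 · # Typ O`** (strictly): by Deuring's formula `2t - h = ½([h(-p)] + h(-4p)) > 0` for `p ≥ 5`, and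
`t = h = 1` for `p = 2, 3`. [cite: Voight2021, Prop. 30.9.2] -/
theorem XiSetup.natCard_classSet_lt_two_mul_natCard_typeSet : Nat.card (ClassSet S.O) < 2 * Nat.card (TypeSet S.O) := by
  have hpp := hp.out
  by_cases hp5 : 5 ≤ p
  · have h := S.four_mul_natCard_typeSet_eq hp5
    have hpos : 0 < BinQF.classNumber (-(4 * (p : ℤ))) := BinQF.classNumber_pos (by omega) (Or.inl (by omega))
    omega
  · have hD : p = 2 ∨ p = 3 := by
      have h2 := hpp.two_le
      interval_cases p
      · exact Or.inl rfl
      · exact Or.inr rfl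
      · exact absurd hpp (by norm_num)
    haveI := xiSetup_subsingleton_classSet_of_mem (D := p) (by tauto) S
    haveI := S.nonempty_classSet
    have ht : Nat.card (TypeSet S.O) = 1 := S.natCard_typeSet_eq_one_of_subsingleton
    have hh : Nat.card (ClassSet S.O) = 1 := Nat.card_unique
    omega

/-- **Every definite quaternion algebra of prime discriminant `p` has a maximal order containing an element of reduced norm
`p`** (a square root of `-p` up to units), i.e. some class is fixed by `[I] ↦ [I P]` — the count `2t - h` of such classes is
positive. [cite: Voight2021, Prop. 30.9.2 and (30.9.3)] -/
theorem XiSetup.exists_leftOrder_rep_reducedNorm_eq_prime :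
    ∃ c : ClassSet S.O, ∃ x ∈ leftOrder c.rep, reducedNorm ℚ S.D x = p := by
  have h := S.two_mul_natCard_typeSet_eq_card_add_card_exists
  have hlt := S.natCard_classSet_lt_two_mul_natCard_typeSet
  have hne : Nat.card {c : ClassSet S.O // ∃ x ∈ leftOrder c.rep, reducedNorm ℚ S.D x = p} ≠ 0 := by omega
  obtain ⟨⟨c, hc⟩⟩ := (Nat.card_ne_zero.mp hne).1
  exact ⟨c, hc⟩

end Deuring

/-! ## §3 Type number one and the first examples -/

section Small

omit hp in
/-- **`# Typ O = 1` for `p ∈ {2, 3, 5, 7, 13}`** (the class-number-one discriminants; Voight Prop. 30.9.2 covers `p = 2, 3`).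
[cite: Voight2021, Prop. 30.9.2 and Thm. 25.4.1] -/
theorem XiSetup.natCard_typeSet_eq_one_of_mem (hD : p = 2 ∨ p = 3 ∨ p = 5 ∨ p = 7 ∨ p = 13) : Nat.card (TypeSet S.O) = 1 := by
  haveI := xiSetup_subsingleton_classSet_of_mem hD S
  exact S.natCard_typeSet_eq_one_of_subsingleton

/-- **Type number one for prime discriminant: `# Typ O = 1 ⟺ p ∈ {2, 3, 5, 7, 13}`** — from `h ≤ 2t`, the class-number lists
`h = 1 ⟺ p ∈ {2,3,5,7,13}`, `h = 2 ⟺ p ∈ {11,17,19}` and Deuring's formula at `p = 11, 17, 19` (where `t = 2`).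
[cite: Voight2021, Prop. 30.9.2, Thm. 25.4.1 and Exercise 30.6] -/
theorem XiSetup.natCard_typeSet_eq_one_iff_of_prime :
    Nat.card (TypeSet S.O) = 1 ↔ (p = 2 ∨ p = 3 ∨ p = 5 ∨ p = 7 ∨ p = 13) := by
  refine ⟨fun ht => ?_, S.natCard_typeSet_eq_one_of_mem⟩
  have hpp := hp.out
  haveI := S.nonempty_classSet
  have hle := S.natCard_classSet_le_two_mul_natCard_typeSet
  have hpos : 0 < Nat.card (ClassSet S.O) := Nat.card_pos
  rw [ht] at hle
  rcases (show Nat.card (ClassSet S.O) = 1 ∨ Nat.card (ClassSet S.O) = 2 by omega) with h1 | h2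
  · exact (Brandt.XiSetup.natCard_classSet_eq_one_iff_of_prime hpp S).mp h1
  · exfalso
    have h4 := S.four_mul_natCard_typeSet_eq
    rcases (Brandt.XiSetup.natCard_classSet_eq_two_iff hpp S).mp h2 with rfl | rfl | rfl
    · have e : ((if 11 % 4 = 3 then BinQF.classNumber (-((11 : ℕ) : ℤ)) else 0) +
          BinQF.classNumber (-(4 * ((11 : ℕ) : ℤ)))) = 4 := by decide
      have := h4 (by norm_num); omega
    · have e : ((if 17 % 4 = 3 then BinQF.classNumber (-((17 : ℕ) : ℤ)) else 0) +
          BinQF.classNumber (-(4 * ((17 : ℕ) : ℤ)))) = 4 := by decide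
      have := h4 (by norm_num); omega
    · have e : ((if 19 % 4 = 3 then BinQF.classNumber (-((19 : ℕ) : ℤ)) else 0) +
          BinQF.classNumber (-(4 * ((19 : ℕ) : ℤ)))) = 4 := by decide
      have := h4 (by norm_num); omega

/-- **`p = 11`: `h = t = 2`** (`h(-11) + h(-44) = 1 + 3`). [cite: Voight2021, Prop. 30.9.2 and Exercise 30.6] -/
theorem XiSetup.natCard_typeSet_eleven (S : XiSetup 1 11) : Nat.card (TypeSet S.O) = 2 := by
  haveI : Fact (Nat.Prime 11) := ⟨by norm_num⟩
  have h4 := S.four_mul_natCard_typeSet_eq (by norm_num)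
  have hh := Brandt.XiSetup.natCard_classSet_eleven S
  have e : ((if 11 % 4 = 3 then BinQF.classNumber (-((11 : ℕ) : ℤ)) else 0) +
      BinQF.classNumber (-(4 * ((11 : ℕ) : ℤ)))) = 4 := by decide
  omega

/-- **`p = 17`: `h = t = 2`** (`h(-68) = 4`). [cite: Voight2021, Prop. 30.9.2 and Exercise 30.6] -/
theorem XiSetup.natCard_typeSet_seventeen (S : XiSetup 1 17) : Nat.card (TypeSet S.O) = 2 := by
  haveI : Fact (Nat.Prime 17) := ⟨by norm_num⟩
  have h4 := S.four_mul_natCard_typeSet_eq (by norm_num)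
  have hh := Brandt.XiSetup.natCard_classSet_seventeen S
  have e : ((if 17 % 4 = 3 then BinQF.classNumber (-((17 : ℕ) : ℤ)) else 0) +
      BinQF.classNumber (-(4 * ((17 : ℕ) : ℤ)))) = 4 := by decide
  omega

/-- **`p = 19`: `h = t = 2`** (`h(-19) + h(-76) = 1 + 3`). [cite: Voight2021, Prop. 30.9.2 and Exercise 30.6] -/
theorem XiSetup.natCard_typeSet_nineteen (S : XiSetup 1 19) : Nat.card (TypeSet S.O) = 2 := by
  haveI : Fact (Nat.Prime 19) := ⟨by norm_num⟩
  have h4 := S.four_mul_natCard_typeSet_eq (by norm_num)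
  have hh := Brandt.XiSetup.natCard_classSet_nineteen S
  have e : ((if 19 % 4 = 3 then BinQF.classNumber (-((19 : ℕ) : ℤ)) else 0) +
      BinQF.classNumber (-(4 * ((19 : ℕ) : ℤ)))) = 4 := by decide
  omega

/-- **`p = 23`: `h = t = 3`** (`h(-23) + h(-92) = 3 + 3`). [cite: Voight2021, Prop. 30.9.2 and Exercise 30.6] -/
theorem XiSetup.natCard_typeSet_twentyThree (S : XiSetup 1 23) : Nat.card (TypeSet S.O) = 3 := by
  haveI : Fact (Nat.Prime 23) := ⟨by norm_num⟩
  have h4 := S.four_mul_natCard_typeSet_eq (by norm_num)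
  have hh := Brandt.XiSetup.natCard_classSet_twentyThree S
  have e : ((if 23 % 4 = 3 then BinQF.classNumber (-((23 : ℕ) : ℤ)) else 0) +
      BinQF.classNumber (-(4 * ((23 : ℕ) : ℤ)))) = 6 := by decide
  omega

/-- **`p = 37`, the first prime with fewer types than classes: `# Cls O = 3` but `# Typ O = 2`** (`h(-148) = 2`).
[cite: Voight2021, Prop. 30.9.2 and Exercise 30.6] -/
theorem XiSetup.natCard_typeSet_thirtySeven (S : XiSetup 1 37) :
    Nat.card (ClassSet S.O) = 3 ∧ Nat.card (TypeSet S.O) = 2 := by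
  haveI : Fact (Nat.Prime 37) := ⟨by norm_num⟩
  have h4 := S.four_mul_natCard_typeSet_eq (by norm_num)
  have hh : Nat.card (ClassSet S.O) = 3 :=
    (Brandt.XiSetup.natCard_classSet_eq_three_iff (by norm_num) S).mpr (Or.inr (Or.inr (Or.inr rfl)))
  have e : ((if 37 % 4 = 3 then BinQF.classNumber (-((37 : ℕ) : ℤ)) else 0) +
      BinQF.classNumber (-(4 * ((37 : ℕ) : ℤ)))) = 2 := by decide
  exact ⟨hh, by omega⟩

end Small

end Brandt

end Literature.NumberTheory.Automorphic
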